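import Summits.CriticalPhenomena.PercolationContinuityZ3.Theorems.Transplant.SkelConcKits
import Literature.Probability.Percolation.GMFiniteSize
import HarnessLib

/-!
# L5.15 (R)/(C) supplement — the per-contact dichotomy `hcon` of the generic kit clause with STRAIGHT ROUTES FROM ORTHANT ROOM:
# hp-8 g24's `SkelI.hcon_win₂_of_room'` (SkelConcKits §3) takes the landing quarter-face in the positive transverse quarter
# `{z a = φ(c) a + τ ℓ, φ(c)(ā) ≤ z(ā) ≤ φ(c)(ā) + ℓ}` (`Skel.faceElt a τ`); the planar rooms of the straight-run and corridor chains
# (p2-g4's record-free `ChainPlanar.Adv.levelBox_room` / `ChainPlanar.Sched.levelBox_room`, SkelConcRootKits §1, from p2-g2's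
# `route_start` / `route_advance`) deliver an ORTHANT face `φ(c) + orthantFace a τ' ℓ` whose transverse sign `τ' ā = ±1` points towards the
# run's centre line — the negative quarter is not a `faceElt` piece.  `Skel.hcon_of_straight` (p3-g4) is stated for every `g : HOct 2`, so the
# fix is bookkeeping: the hyperoctahedral element `g := (swap 0 a, τ' ∘ swap 0 a)` with `orthantFace a τ' ℓ = GM.piece g ℓ` (Literature's
# `orthantFace_eq_piece`), the footprint of `macroPiece c ℓ R g` in `φ(c) + orthantFace a τ' ℓ`, the room lemma
# `macroPiece_orthant_subset_Win`, and **`SkelI.hcon_win₂_of_roomO`** = `hcon_win₂` + `hcon_of_straight` at that `g` with the room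
# hypothesis in the `levelBox_room` shape (`(box 2 ℓ).image (· + φ c) ⊆ Dpl`, `(orthantFace a τ' ℓ).image (· + φ c) ⊆ Tpl`).
# Consumers: the (R) root-run clauses `Skel.hkits_rootWAD` (p2, next file) and the (C) corridor clauses (p5 lineage).

builds on p205010 (kernel theorem, internal audit signed; external expert review pending) — nothing in this file uses p205010.
Status sentence (coordinator 2026-08-20T04:30Z): "θ(p_c) = 0 on ℤ^d, all d ≥ 2 — kernel-verified (Lean 4/Mathlib, standard axioms); internal
adversarial audit SIGNED 2026-08-20 04:29Z; external expert review pending."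
Lane `prim-bschramm-*`, seat `prim-bschramm-p2` (gen 5; (R) = p2 lineage, SHEAR-SCOPE §3.9 Layer 6); helper file (`--supports stmt-CriticalPhenomena-4575`).
* §1 `Skel.φ_sub_mem_orthantFace_of_mem_macroPiece`, `Skel.macroPiece_orthant_subset_Win`;
* §2 **`SkelI.hcon_win₂_of_roomO`** (input margin `δ²`, the `hcon` shape of p1-g7's `SkelI.kitClause`).
[cite: KozmaNitzan2024, §4 Lemma 10 Step IV (p. 20), Lemma 11 (pp. 22–23)] [cite: GrimmettPercolation1999, §7.2 p. 151 (the 2^d d! copies of T(n))]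
-/

noncomputable section

open MeasureTheory
open scoped Classical

namespace Summit.CriticalPhenomena.PercolationContinuityZ3.Theorems

namespace Transplant

/-! ## §1 Orthant quarter-pieces of a cylinder ball: footprint and room -/

namespace Skel

open Literature.Probability.Percolation Literature.Probability.LatticeModels SimpleGraph
open Literature.Probability.Percolation.GM (HOct sp piece facePiece)
open Literature.Barriers.CriticalPhenomena (graphBall graphBall_mono)

variable {V : Type} {G : SimpleGraph V} [G.LocallyFinite] (Φ : PlanarSkeletonConc G)

/-- **Footprint of an orthant quarter-piece**: the relative skeleton coordinate of every vertex of the `(swap 0 a, τ ∘ swap 0 a)`-quarter-piece `macroPiece c ℓ R g` lies in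
`orthantFace a τ ℓ`. [folklore] -/
theorem φ_sub_mem_orthantFace_of_mem_macroPiece {c u : V} {ℓ R : ℕ} {a : Fin 2} {τ : Fin 2 → ℤˣ}
    (hu : u ∈ macroPiece Φ c ℓ R ((Equiv.swap 0 a, fun i => τ (Equiv.swap 0 a i)) : HOct 2)) :
    Φ.φ u - Φ.φ c ∈ orthantFace a τ ℓ := by
  rw [orthantFace_eq_piece, piece, Finset.mem_filter]
  rw [macroPiece, Finset.mem_filter, mem_cylBallFin] at hu
  exact ⟨(Φ.toPlanarSkeleton.mem_cyl c ℓ u).1 (cylBall_subset_cyl Φ c ℓ R hu.1), hu.2⟩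

/-- **Room for an orthant quarter-piece in a plain window**: deepness `B_G(c, R) ⊆ B_G(w₀, R')` and the planar orthant face
`φ(c) + orthantFace a τ ℓ ⊆ P` give `macroPiece c ℓ R (swap 0 a, τ ∘ swap 0 a) ⊆ Win w₀ P R'` (orthant form of p3-g4's `macroPiece_faceElt_subset_Win`).
[cite: KozmaNitzan2024, §4 Lemma 11 (p. 23)] -/
theorem macroPiece_orthant_subset_Win {c w₀ : V} {ℓ R R' : ℕ} {a : Fin 2} {τ : Fin 2 → ℤˣ} {P : Finset (Site 2)}
    (hball : graphBall G c R ⊆ graphBall G w₀ R') (hP : (orthantFace a τ ℓ).image (fun s => s + Φ.φ c) ⊆ P) :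
    macroPiece Φ c ℓ R ((Equiv.swap 0 a, fun i => τ (Equiv.swap 0 a i)) : HOct 2) ⊆ Φ.Win w₀ P R' :=
  macroPiece_subset_Win Φ hball fun u hu =>
    hP (Finset.mem_image.2 ⟨Φ.φ u - Φ.φ c, φ_sub_mem_orthantFace_of_mem_macroPiece Φ hu, sub_add_cancel _ _⟩)

end Skel

/-! ## §2 The dichotomy with straight routes from ORTHANT room -/

namespace SkelI

open Literature.Probability.Percolation Literature.Probability.LatticeModels SimpleGraph KNLevels KozmaNitzan
open Literature.Probability.Percolation.GM (HOct)
open Literature.Probability.Percolation.KozmaNitzan.Cells (oth)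
open Literature.Barriers.CriticalPhenomena (graphBall graphBall_mono)
open Skel (winGraph winGraph_le winLevel inNbr fatSeq macroPiece fatRadius cubeCtr cubeFace mem_graphBall_of_mem_fatSeq)

variable {V : Type} [DecidableEq V] {G : SimpleGraph V} [G.LocallyFinite] (Φ : PlanarSkeletonConc G)

section Dichotomy

variable [Countable V] {p : unitInterval} (hC : Φ.toPlanarSkeleton.CylSubcritical p) {msel : V → ℕ} {Ssc : Finset ℕ} {q : unitInterval}
  {δ : ℝ} {M : ℕ} {w₀ : V} {R : ℕ} {lo hi : Site 2} {j ℓs R' r₀ rs cU : ℕ} {Wt : Sym2 V → unitInterval} {D T : Finset V}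
  {Rt L'' Ldeep : ℕ} {Unear : V → Finset V}

/-- **The per-contact dichotomy `hcon` for a window step with true target + rim and STRAIGHT deep routes from ORTHANT ROOM** (root /
corridor / inner steps): as hp-8 g24's `hcon_win₂_of_room'`, but the room hypothesis is in the shape delivered by the planar chains
(`ChainPlanar.Adv.levelBox_room`, `ChainPlanar.Sched.levelBox_room`): for every near contact a route scale `ℓ ∈ Ssc`, `M < ℓ`, `ψ ℓ ≤ Ldeep`,
with `φ(c x) + Λ_ℓ ⊆ Dpl` and an orthant face `φ(c x) + orthantFace a τ ℓ ⊆ Tpl` (any signs `τ : Fin 2 → ℤˣ`), where `D ⊇ Win w₀ Dpl R` and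
`T ⊇ Win w₀ Tpl Rt`; input margin `δ²` (the shape of p1-g7's `SkelI.kitClause`). [cite: KozmaNitzan2024, §4 Lemma 10 Step IV (p. 20), Lemma 11 (pp. 22–23)] -/
theorem hcon_win₂_of_roomO (hUdef : ∀ x ∈ outerBoundary (winGraph G w₀ R) (winLevel Φ w₀ R lo hi j),
      (inNbr Φ w₀ R (Finset.Icc (lo - (j : Site 2)) (hi + (j : Site 2))) x) ∈ graphBall G w₀ (R - r₀) →
      Unear x = (cubeFace Φ hC (deepCtr Φ w₀ R (lo - (j : Site 2)) (hi + (j : Site 2)) ℓs M x) (exitDir Φ w₀ R (lo - (j : Site 2)) (hi + (j : Site 2)) x).1 (exitDir Φ w₀ R (lo - (j : Site 2)) (hi + (j : Site 2)) x).2 ℓs M))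
    (hU : NearFaceOKDeep Φ w₀ R lo hi j ℓs M R' r₀ rs cU Unear)
    (hTrim : ∀ v ∈ winLevel Φ w₀ R lo hi j, v ∉ graphBall G w₀ (Rt - L'') → v ∈ T) (hRL : Rt - L'' ≤ R - r₀)
    (hL : Ldeep + fatRadius Φ hC M ≤ L'') (hLR : L'' ≤ Rt) (hRtR : Rt ≤ R)
    (hWD : IsSubbox (winGraph G w₀ R) Wt q D) {Dpl Tpl : Finset (Site 2)} (hDpl : Φ.Win w₀ Dpl R ⊆ D) (hTpl : Φ.Win w₀ Tpl Rt ⊆ T)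
    (hroom : ∀ x ∈ outerBoundary (winGraph G w₀ R) (winLevel Φ w₀ R lo hi j),
      (inNbr Φ w₀ R (Finset.Icc (lo - (j : Site 2)) (hi + (j : Site 2))) x) ∈ graphBall G w₀ (R - r₀) →
      ∃ ℓ ∈ Ssc, M < ℓ ∧ fatRadius Φ hC ℓ ≤ Ldeep ∧
        (box 2 ℓ).image (fun s => s + Φ.φ (cubeCtr Φ (deepCtr Φ w₀ R (lo - (j : Site 2)) (hi + (j : Site 2)) ℓs M x) (exitDir Φ w₀ R (lo - (j : Site 2)) (hi + (j : Site 2)) x).1 (exitDir Φ w₀ R (lo - (j : Site 2)) (hi + (j : Site 2)) x).2 ℓs M)) ⊆ Dpl ∧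
        ∃ (a : Fin 2) (τ : Fin 2 → ℤˣ), (orthantFace a τ ℓ).image (fun s => s + Φ.φ (cubeCtr Φ (deepCtr Φ w₀ R (lo - (j : Site 2)) (hi + (j : Site 2)) ℓs M x) (exitDir Φ w₀ R (lo - (j : Site 2)) (hi + (j : Site 2)) x).1 (exitDir Φ w₀ R (lo - (j : Site 2)) (hi + (j : Site 2)) x).2 ℓs M)) ⊆ Tpl) :
    ∀ x ∈ outerBoundary (winGraph G w₀ R) (winLevel Φ w₀ R lo hi j),
      (∃ u ∈ (slabGeomDeep Φ w₀ R lo hi j ℓs M R' r₀ Unear).U x, u ∈ T) ∨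
      ((inNbr Φ w₀ R (Finset.Icc (lo - (j : Site 2)) (hi + (j : Site 2))) x) ∈ graphBall G w₀ (R - r₀) ∧ ∀ t ∈ Φ.types,
        (∀ M' ∈ Ssc, 1 - δ ^ 2 < (bondPercolation G q).real (UniqZone.zone G (fatSeq Φ hC (cubeCtr Φ (deepCtr Φ w₀ R (lo - (j : Site 2)) (hi + (j : Site 2)) ℓs M x) (exitDir Φ w₀ R (lo - (j : Site 2)) (hi + (j : Site 2)) x).1 (exitDir Φ w₀ R (lo - (j : Site 2)) (hi + (j : Site 2)) x).2 ℓs M)) (msel t) M') ∧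
          ∀ g' : HOct 2, 1 - δ ^ 2 < (bondPercolation G q).real
            (linkIn (↑(fatSeq Φ hC (cubeCtr Φ (deepCtr Φ w₀ R (lo - (j : Site 2)) (hi + (j : Site 2)) ℓs M x) (exitDir Φ w₀ R (lo - (j : Site 2)) (hi + (j : Site 2)) x).1 (exitDir Φ w₀ R (lo - (j : Site 2)) (hi + (j : Site 2)) x).2 ℓs M) M')) (fatSeq Φ hC (cubeCtr Φ (deepCtr Φ w₀ R (lo - (j : Site 2)) (hi + (j : Site 2)) ℓs M x) (exitDir Φ w₀ R (lo - (j : Site 2)) (hi + (j : Site 2)) x).1 (exitDir Φ w₀ R (lo - (j : Site 2)) (hi + (j : Site 2)) x).2 ℓs M) (msel t)) (macroPiece Φ (cubeCtr Φ (deepCtr Φ w₀ R (lo - (j : Site 2)) (hi + (j : Site 2)) ℓs M x) (exitDir Φ w₀ R (lo - (j : Site 2)) (hi + (j : Site 2)) x).1 (exitDir Φ w₀ R (lo - (j : Site 2)) (hi + (j : Site 2)) x).2 ℓs M) M' (fatRadius Φ hC M') g'))) →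
        ∃ Qt Ft : Finset V, Ft ⊆ T ∧ Qt ⊆ D ∧ (∀ u ∈ Qt, ∀ v ∈ Qt, G.Adj u v → (winGraph G w₀ R).Adj u v) ∧
          Disjoint Ft (fatSeq Φ hC (cubeCtr Φ (deepCtr Φ w₀ R (lo - (j : Site 2)) (hi + (j : Site 2)) ℓs M x) (exitDir Φ w₀ R (lo - (j : Site 2)) (hi + (j : Site 2)) x).1 (exitDir Φ w₀ R (lo - (j : Site 2)) (hi + (j : Site 2)) x).2 ℓs M) M) ∧
          1 - δ ^ 2 < (prodBernoulli Wt).real (linkIn (↑Qt) (fatSeq Φ hC (cubeCtr Φ (deepCtr Φ w₀ R (lo - (j : Site 2)) (hi + (j : Site 2)) ℓs M x) (exitDir Φ w₀ R (lo - (j : Site 2)) (hi + (j : Site 2)) x).1 (exitDir Φ w₀ R (lo - (j : Site 2)) (hi + (j : Site 2)) x).2 ℓs M) (msel t)) Ft)) := by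
  refine hcon_win₂ Φ hC hUdef hU hTrim hRL hL hLR fun x hx hnear hdeep t _ hin => ?_
  obtain ⟨ℓ, hℓ, hMℓ, hψ, hroomD, a, τ, hroomT⟩ := hroom x hx hnear
  have hballR : graphBall G (cubeCtr Φ (deepCtr Φ w₀ R (lo - (j : Site 2)) (hi + (j : Site 2)) ℓs M x) (exitDir Φ w₀ R (lo - (j : Site 2)) (hi + (j : Site 2)) x).1 (exitDir Φ w₀ R (lo - (j : Site 2)) (hi + (j : Site 2)) x).2 ℓs M) (fatRadius Φ hC ℓ) ⊆ graphBall G w₀ R :=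
    ((graphBall_mono G _ hψ).trans hdeep).trans (graphBall_mono G w₀ hRtR)
  have hballRt : graphBall G (cubeCtr Φ (deepCtr Φ w₀ R (lo - (j : Site 2)) (hi + (j : Site 2)) ℓs M x) (exitDir Φ w₀ R (lo - (j : Site 2)) (hi + (j : Site 2)) x).1 (exitDir Φ w₀ R (lo - (j : Site 2)) (hi + (j : Site 2)) x).2 ℓs M) (fatRadius Φ hC ℓ) ⊆ graphBall G w₀ Rt := (graphBall_mono G _ hψ).trans hdeep
  have hQD : fatSeq Φ hC (cubeCtr Φ (deepCtr Φ w₀ R (lo - (j : Site 2)) (hi + (j : Site 2)) ℓs M x) (exitDir Φ w₀ R (lo - (j : Site 2)) (hi + (j : Site 2)) x).1 (exitDir Φ w₀ R (lo - (j : Site 2)) (hi + (j : Site 2)) x).2 ℓs M) ℓ ⊆ D :=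
    (Skel.fatSeq_subset_Win Φ hC hballR fun y hy => by
      rw [add_comm]; exact hroomD (Finset.mem_image_of_mem _ hy)).trans hDpl
  have hQ : ∀ u ∈ fatSeq Φ hC (cubeCtr Φ (deepCtr Φ w₀ R (lo - (j : Site 2)) (hi + (j : Site 2)) ℓs M x) (exitDir Φ w₀ R (lo - (j : Site 2)) (hi + (j : Site 2)) x).1 (exitDir Φ w₀ R (lo - (j : Site 2)) (hi + (j : Site 2)) x).2 ℓs M) ℓ, ∀ v ∈ fatSeq Φ hC (cubeCtr Φ (deepCtr Φ w₀ R (lo - (j : Site 2)) (hi + (j : Site 2)) ℓs M x) (exitDir Φ w₀ R (lo - (j : Site 2)) (hi + (j : Site 2)) x).1 (exitDir Φ w₀ R (lo - (j : Site 2)) (hi + (j : Site 2)) x).2 ℓs M) ℓ, G.Adj u v → (winGraph G w₀ R).Adj u v :=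
    Skel.adj_winGraph_of_subset_graphBall fun u hu => hballR (mem_graphBall_of_mem_fatSeq Φ hC hu)
  have hT : macroPiece Φ (cubeCtr Φ (deepCtr Φ w₀ R (lo - (j : Site 2)) (hi + (j : Site 2)) ℓs M x) (exitDir Φ w₀ R (lo - (j : Site 2)) (hi + (j : Site 2)) x).1 (exitDir Φ w₀ R (lo - (j : Site 2)) (hi + (j : Site 2)) x).2 ℓs M) ℓ (fatRadius Φ hC ℓ)
      ((Equiv.swap 0 a, fun i => τ (Equiv.swap 0 a i)) : HOct 2) ⊆ T :=
    (Skel.macroPiece_orthant_subset_Win Φ hballRt hroomT).trans hTpl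
  have hin' : ∀ M' ∈ Ssc, 1 - δ ^ 2 < (bondPercolation G q).real (UniqZone.zone G (fatSeq Φ hC (cubeCtr Φ (deepCtr Φ w₀ R (lo - (j : Site 2)) (hi + (j : Site 2)) ℓs M x) (exitDir Φ w₀ R (lo - (j : Site 2)) (hi + (j : Site 2)) x).1 (exitDir Φ w₀ R (lo - (j : Site 2)) (hi + (j : Site 2)) x).2 ℓs M)) (msel t) M') ∧
      ∀ g' : HOct 2, 1 - δ ^ 2 < (bondPercolation G q).real
        (linkIn (↑(fatSeq Φ hC (cubeCtr Φ (deepCtr Φ w₀ R (lo - (j : Site 2)) (hi + (j : Site 2)) ℓs M x) (exitDir Φ w₀ R (lo - (j : Site 2)) (hi + (j : Site 2)) x).1 (exitDir Φ w₀ R (lo - (j : Site 2)) (hi + (j : Site 2)) x).2 ℓs M) M')) (fatSeq Φ hC (cubeCtr Φ (deepCtr Φ w₀ R (lo - (j : Site 2)) (hi + (j : Site 2)) ℓs M x) (exitDir Φ w₀ R (lo - (j : Site 2)) (hi + (j : Site 2)) x).1 (exitDir Φ w₀ R (lo - (j : Site 2)) (hi + (j : Site 2)) x).2 ℓs M) (msel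 t)) (macroPiece Φ (cubeCtr Φ (deepCtr Φ w₀ R (lo - (j : Site 2)) (hi + (j : Site 2)) ℓs M x) (exitDir Φ w₀ R (lo - (j : Site 2)) (hi + (j : Site 2)) x).1 (exitDir Φ w₀ R (lo - (j : Site 2)) (hi + (j : Site 2)) x).2 ℓs M) M' (fatRadius Φ hC M') g')) := hin
  exact Skel.hcon_of_straight Φ hC (winGraph_le G w₀ R) hWD hℓ hMℓ hQD hQ hT hin'

end Dichotomy

end SkelI

end Transplant

end Summit.CriticalPhenomena.PercolationContinuityZ3.Theorems

end
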